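import Summits.BirchSwinnertonDyer.BirchSwinnertonDyer.Theorems.ManinLocalTwoThreeShiftRelationDepth
import Summits.BirchSwinnertonDyer.BirchSwinnertonDyer.Theorems.ManinLocalTwoThreeHeckeAdAtkinLehner
import HarnessLib

/-!
# The `t = 2` vertex step, part 1: a `2`-shift-invariant homomorphism on `Γ₀(2L′)` is `Γ₀(L′)`-stable
# (MEMO-es §25.3 (V-a), E-es-41m at `t = 2`)

Summit `BirchSwinnertonDyer`, route `ManinLocalTwoThree` (cell bsd-f2-manin), crux C2 `ManinOddAtFour` (stmt-BirchSwinnertonDyer-22967),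
line `kato_shift_two` v6, stub 3 (`C₃`-image residual), VERTEX STEP of the Bass–Serre descent at `t = 2` (lead assignment, cell INBOX
2026-08-28T04:46:01Z; es USE MAP 04:30:03Z).  Let `L′` be odd and `u : Γ₀(2L′) → K` a homomorphism (degree-`0` cocycle) which is
`2`-SHIFT-INVARIANT (`π₂^* u = π₁^* u` on `Γ₀(4L′)`, i.e. `u(AγA⁻¹) = u(γ)` for `γ ∈ Γ₀(4L′)`, `A = diag(2,1)`).  We prove the
STABILITY hypothesis of the transfer lemma `exists_extension_of_stable_of_index_invertible` (EXT-ODD, p605692) for the pair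
`Γ₀(2L′) ≤ Γ₀(L′)`: **`apply_inv_conj_eq_of_shiftInvariant`** — for `g ∈ Γ₀(L′)` and `h ∈ Γ₀(2L′)` with `g⁻¹hg ∈ Γ₀(2L′)`,
`u(g⁻¹hg) = u(h)`.  Mechanism (mod `2`, `Γ₀(L′)/Γ₀(L′)∩Γ(2) = SL₂(𝔽₂) = S₃`, `Γ₀(2L′) ↦ ⟨τ̄⟩`): if `g ∉ Γ₀(2L′)` the hypothesis forces
`h ≡ 1`, i.e. `2 ∣ h₀₁` (`even_of_inv_conj_mem`: the centraliser of `τ̄` is `⟨τ̄⟩`); after replacing `g` by `τ^i g τ^j` one may assume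
`2 ∣ g₀₁`, and then `g`, `h` are the `2`-shifts of `g′, h′ ∈ Γ₀(2L′)`, so `u(g⁻¹hg) = u(g′⁻¹h′g′) = u(h′) = u(h)` by shift-invariance
twice and conjugation-invariance inside `Γ₀(2L′)` (`apply_inv_conj_eq_of_even`).  Part 2 (`…VertexTwo.lean`) computes the index `3` and
applies EXT-ODD.  No new definitions; nothing about BSD or Manin's conjecture is proved here.

References: J.-P. Serre, *Trees*, II.1.4; K. S. Brown, *Cohomology of Groups*, III.9–10 [cite: Brown1982, III.10.3]; G. Shimura (1971)
§8.3 [cite: Shimura1971, §8.3 (8.3.2)]; cell memo HOME/MEMO-es.md §25.3 (V-a), §25.11; INBOX 2026-08-28T04:30:03Z (es USE MAP).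
-/

set_option autoImplicit false
set_option linter.dupNamespace false

open scoped MatrixGroups

open CongruenceSubgroup Matrix.SpecialLinearGroup Literature.NumberTheory.EllipticCurves.ModularForms
  Literature.NumberTheory.EllipticCurves.ModularForms.HidaCohomology

namespace Summit.BirchSwinnertonDyer.BirchSwinnertonDyer.Theorems.ManinLocalTwoThree

/-! ### Parities of entries -/

section Parity

/-- The determinant of an element of `SL₂(ℤ)` read mod `2`. [folklore] -/
theorem det_cast_zmod_two (γ : SL(2, ℤ)) :
    ((γ 0 0 : ℤ) : ZMod 2) * ((γ 1 1 : ℤ) : ZMod 2) - ((γ 0 1 : ℤ) : ZMod 2) * ((γ 1 0 : ℤ) : ZMod 2) = 1 := by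
  have h := congrArg (Int.cast : ℤ → ZMod 2) (det_entries γ)
  push_cast at h
  exact h

/-- If `γ₁₀` is even then `γ₀₀` and `γ₁₁` are odd. [folklore] -/
theorem cast_zmod_two_eq_one_of_apply_one_zero (γ : SL(2, ℤ)) (h : ((γ 1 0 : ℤ) : ZMod 2) = 0) :
    ((γ 0 0 : ℤ) : ZMod 2) = 1 ∧ ((γ 1 1 : ℤ) : ZMod 2) = 1 := by
  have two : ∀ x : ZMod 2, x = 0 ∨ x = 1 := by decide
  have hdet := det_cast_zmod_two γ
  rw [h, mul_zero, sub_zero] at hdet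
  rcases two ((γ 0 0 : ℤ) : ZMod 2) with h0 | h0
  · rw [h0, zero_mul] at hdet; exact absurd hdet zero_ne_one
  rcases two ((γ 1 1 : ℤ) : ZMod 2) with h1 | h1
  · rw [h1, mul_zero] at hdet; exact absurd hdet zero_ne_one
  exact ⟨h0, h1⟩

/-- `2 ∣ x` iff `x ≡ 0 (mod 2)` (cast form). [folklore] -/
theorem two_dvd_iff_cast_zmod_two_eq_zero (x : ℤ) : (2 : ℤ) ∣ x ↔ ((x : ℤ) : ZMod 2) = 0 := by
  rw [ZMod.intCast_zmod_eq_zero_iff_dvd]; norm_num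

variable {L' : ℕ}

/-- For `γ ∈ Γ₀(L′)` with `L′` odd: `γ ∈ Γ₀(2L′) ⟺ γ₁₀` is even. [folklore] -/
theorem mem_Gamma0_mul_two_iff (hL' : ¬ 2 ∣ L') {γ : SL(2, ℤ)} (hγ : γ ∈ Gamma0 L') :
    γ ∈ Gamma0 (L' * 2) ↔ ((γ 1 0 : ℤ) : ZMod 2) = 0 := by
  rw [Gamma0_mem, ZMod.intCast_zmod_eq_zero_iff_dvd, ← two_dvd_iff_cast_zmod_two_eq_zero, Nat.cast_mul, Nat.cast_ofNat]
  rw [Gamma0_mem, ZMod.intCast_zmod_eq_zero_iff_dvd] at hγ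
  constructor
  · exact fun h ↦ (dvd_mul_left _ _).trans h
  · intro h
    have hcop : IsCoprime (L' : ℤ) ((2 : ℕ) : ℤ) :=
      Nat.isCoprime_iff_coprime.mpr ((Nat.Prime.coprime_iff_not_dvd Nat.prime_two).mpr hL').symm
    rw [Nat.cast_ofNat] at hcop
    exact hcop.mul_dvd hγ h

/-- `γ₁₀` is even for `γ ∈ Γ₀(2L′)`. [folklore] -/
theorem cast_zmod_two_apply_one_zero (γ : Gamma0 (L' * 2)) : (((γ : SL(2, ℤ)) 1 0 : ℤ) : ZMod 2) = 0 := by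
  rw [← two_dvd_iff_cast_zmod_two_eq_zero]
  have hd := natCast_dvd_gamma0_apply_one_zero γ
  rw [Nat.cast_mul, Nat.cast_ofNat] at hd
  exact (dvd_mul_left _ _).trans hd

/-- Entries of `g T` and `T g`, `T = (1 1; 0 1)`. [folklore] -/
theorem mul_T_apply (g : SL(2, ℤ)) :
    (g * ModularGroup.T) 0 1 = g 0 0 + g 0 1 ∧ (g * ModularGroup.T) 1 0 = g 1 0 ∧
      (ModularGroup.T * g) 0 0 = g 0 0 + g 1 0 ∧ (ModularGroup.T * g) 0 1 = g 0 1 + g 1 1 ∧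
      (ModularGroup.T * g) 1 0 = g 1 0 := by
  simp [Matrix.SpecialLinearGroup.coe_mul, ModularGroup.coe_T, Matrix.mul_apply, Fin.sum_univ_two]

end Parity

/-! ### Stability of a `2`-shift-invariant homomorphism on `Γ₀(2L′)` under `Γ₀(L′)`-conjugation -/

section Stability

variable {L' : ℕ} [NeZero L'] {K : Type*} [CommRing K] {u : Gamma0 (L' * 2) → Fin 1 → K}
  (hu : u ∈ cocycles 0 (L' * 2) K)
  (hshift : degeneracyPullback 0 (L' * 2) (L' * 2 * 2) 2 K dvd_rfl u =
    degeneracyPullback 0 (L' * 2) (L' * 2 * 2) 1 K (by simp) u)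
include hu

omit [NeZero L'] in
/-- Conjugation invariance inside `Γ₀(2L′)`: `u(γ⁻¹δγ) = u(δ)`. [folklore] -/
theorem cocycle_zero_inv_conj (γ δ : Gamma0 (L' * 2)) : u (γ⁻¹ * δ * γ) = u δ := by
  rw [cocycle_zero_mul hu, cocycle_zero_mul hu, cocycle_zero_inv hu]
  abel

include hshift

omit hu in
/-- **`2`-shift invariance on entries** (the tree's `apply_eq_of_shiftInvariant` at `n = 1`): `u γ′ = u γ` whenever `γ′` is the
`2`-shift of `γ`. [cite: Shimura1971, §8.3 (8.3.2)] -/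
theorem apply_eq_of_shiftInvariant_two (γ γ' : Gamma0 (L' * 2))
    (hR : (γ' : SL(2, ℤ)) 0 0 = (γ : SL(2, ℤ)) 0 0 ∧ (γ' : SL(2, ℤ)) 0 1 = 2 * (γ : SL(2, ℤ)) 0 1 ∧
      2 * (γ' : SL(2, ℤ)) 1 0 = (γ : SL(2, ℤ)) 1 0 ∧ (γ' : SL(2, ℤ)) 1 1 = (γ : SL(2, ℤ)) 1 1) :
    u γ' = u γ :=
  apply_eq_of_shiftInvariant (t := 2) (n := 1) (L := L' * 2) hshift γ γ'
    (by simpa only [Nat.cast_ofNat, pow_one] using hR)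

/-- **The even case.**  If `g ∈ Γ₀(L′)` and `h ∈ Γ₀(2L′)` both have even upper-right entry and `g⁻¹hg ∈ Γ₀(2L′)`, then
`u(g⁻¹hg) = u(h)`: `g`, `h` are the `2`-shifts of `g′, h′ ∈ Γ₀(2L′)` and `u(g⁻¹hg) = u(g′⁻¹h′g′) = u(h′) = u(h)`.
[cite: Brown1982, III.10.3] -/
theorem apply_inv_conj_eq_of_even {g : SL(2, ℤ)} (hg : g ∈ Gamma0 L') (hg01 : (2 : ℤ) ∣ g 0 1) (h : Gamma0 (L' * 2))
    (hh01 : (2 : ℤ) ∣ (h : SL(2, ℤ)) 0 1) (hk : g⁻¹ * (h : SL(2, ℤ)) * g ∈ Gamma0 (L' * 2)) :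
    u ⟨g⁻¹ * h * g, hk⟩ = u h := by
  obtain ⟨g', hg1, hg2, hg3, hg4⟩ := exists_shiftRel_down g hg01
  obtain ⟨h', hh1, hh2, hh3, hh4⟩ := exists_shiftRel_down (h : SL(2, ℤ)) hh01
  have hL'g : (L' : ℤ) ∣ g 1 0 := natCast_dvd_gamma0_apply_one_zero ⟨g, hg⟩
  have hg'mem : g' ∈ Gamma0 (L' * 2) := by
    rw [Gamma0_mem, ZMod.intCast_zmod_eq_zero_iff_dvd, Nat.cast_mul, Nat.cast_ofNat, ← hg3, mul_comm (L' : ℤ) 2]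
    exact mul_dvd_mul_left 2 hL'g
  have hh'mem : h' ∈ Gamma0 (L' * 2) := by
    have hd := natCast_dvd_gamma0_apply_one_zero h
    rw [Nat.cast_mul, Nat.cast_ofNat] at hd
    rw [Gamma0_mem, ZMod.intCast_zmod_eq_zero_iff_dvd, Nat.cast_mul, Nat.cast_ofNat, ← hh3]
    exact dvd_mul_of_dvd_right hd 2
  -- `g⁻¹ h g` is the `2`-shift of `g′⁻¹ h′ g′`
  have hR := shiftRel_mul (2 : ℤ) (shiftRel_mul (2 : ℤ) (shiftRel_inv (2 : ℤ) ⟨hg1, hg2, hg3, hg4⟩) ⟨hh1, hh2, hh3, hh4⟩)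
    ⟨hg1, hg2, hg3, hg4⟩
  have hmem : g'⁻¹ * h' * g' ∈ Gamma0 (L' * 2) :=
    Subgroup.mul_mem _ (Subgroup.mul_mem _ (Subgroup.inv_mem _ hg'mem) hh'mem) hg'mem
  rw [apply_eq_of_shiftInvariant_two hshift ⟨g'⁻¹ * h' * g', hmem⟩ ⟨g⁻¹ * h * g, hk⟩ hR]
  have e1 : (⟨g'⁻¹ * h' * g', hmem⟩ : Gamma0 (L' * 2)) = ⟨g', hg'mem⟩⁻¹ * ⟨h', hh'mem⟩ * ⟨g', hg'mem⟩ := rfl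
  rw [e1, cocycle_zero_inv_conj hu]
  exact (apply_eq_of_shiftInvariant_two hshift ⟨h', hh'mem⟩ h ⟨hh1, hh2, hh3, hh4⟩).symm

omit [NeZero L'] hu hshift in
/-- **Off `Γ₀(2L′)` the hypothesis forces `h ≡ 1 (mod 2)`**: if `g ∈ Γ₀(L′)` has ODD lower-left entry, `h ∈ Γ₀(2L′)` and
`g⁻¹hg ∈ Γ₀(2L′)`, then `2 ∣ h₀₁` (in `S₃ = SL₂(𝔽₂)` the centraliser of `τ̄` is `⟨τ̄⟩`). [cite: Brown1982, III.10.3] -/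
theorem even_of_inv_conj_mem {g : SL(2, ℤ)} (hg10 : ((g 1 0 : ℤ) : ZMod 2) = 1) (h : Gamma0 (L' * 2))
    (hk : g⁻¹ * (h : SL(2, ℤ)) * g ∈ Gamma0 (L' * 2)) : (2 : ℤ) ∣ (h : SL(2, ℤ)) 0 1 := by
  have hc := cast_zmod_two_apply_one_zero h
  obtain ⟨ha, hd⟩ := cast_zmod_two_eq_one_of_apply_one_zero (h : SL(2, ℤ)) hc
  have hE := cast_zmod_two_apply_one_zero ⟨g⁻¹ * (h : SL(2, ℤ)) * g, hk⟩
  have hentry : ((g⁻¹ * (h : SL(2, ℤ)) * g : SL(2, ℤ)) : Matrix (Fin 2) (Fin 2) ℤ) 1 0 =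
      (-(g 1 0 * (h : SL(2, ℤ)) 0 0) + g 0 0 * (h : SL(2, ℤ)) 1 0) * g 0 0 +
        (-(g 1 0 * (h : SL(2, ℤ)) 0 1) + g 0 0 * (h : SL(2, ℤ)) 1 1) * g 1 0 := by
    rw [Matrix.SpecialLinearGroup.coe_mul, Matrix.SpecialLinearGroup.coe_mul, sl_inv_conj_eq]
    simp only [Matrix.of_apply, Matrix.cons_val', Matrix.cons_val_zero, Matrix.cons_val_one, Matrix.empty_val',
      Matrix.cons_val_fin_one]
  have hE' : (((-(g 1 0 * (h : SL(2, ℤ)) 0 0) + g 0 0 * (h : SL(2, ℤ)) 1 0) * g 0 0 +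
      (-(g 1 0 * (h : SL(2, ℤ)) 0 1) + g 0 0 * (h : SL(2, ℤ)) 1 1) * g 1 0 : ℤ) : ZMod 2) = 0 := by
    rw [← hentry]; exact hE
  push_cast at hE'
  rw [two_dvd_iff_cast_zmod_two_eq_zero]
  linear_combination (-1 : ZMod 2) * hE' + ((g 0 0 : ℤ) : ZMod 2) * hd - ((g 0 0 : ℤ) : ZMod 2) * ha +
    ((g 0 0 : ℤ) : ZMod 2) ^ 2 * hc +
    (((g 0 0 : ℤ) : ZMod 2) * (((h : SL(2, ℤ)) 1 1 : ℤ) : ZMod 2) - (((h : SL(2, ℤ)) 0 0 : ℤ) : ZMod 2) * ((g 0 0 : ℤ) : ZMod 2) -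
      2 * (((h : SL(2, ℤ)) 0 1 : ℤ) : ZMod 2) - (((h : SL(2, ℤ)) 0 1 : ℤ) : ZMod 2) * (((g 1 0 : ℤ) : ZMod 2) - 1)) * hg10

/-- **STABILITY** (the transfer lemma's hypothesis for `Γ₀(2L′) ≤ Γ₀(L′)`): for `g ∈ Γ₀(L′)`, `h ∈ Γ₀(2L′)` with
`g⁻¹hg ∈ Γ₀(2L′)`, `u(g⁻¹hg) = u(h)`.  Cases on `g mod 2`: `g ∈ Γ₀(2L′)` (conjugation invariance); `2 ∣ g₀₁` (the even case);
otherwise `gτ`, `τg` or `τgτ` has even upper-right entry (`τ = (1 1; 0 1) ∈ Γ₀(2L′)`). [cite: Brown1982, III.10.3] -/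
theorem apply_inv_conj_eq_of_shiftInvariant (hL' : ¬ 2 ∣ L') {g : SL(2, ℤ)} (hg : g ∈ Gamma0 L') (h : Gamma0 (L' * 2))
    (hk : g⁻¹ * (h : SL(2, ℤ)) * g ∈ Gamma0 (L' * 2)) : u ⟨g⁻¹ * h * g, hk⟩ = u h := by
  have two : ∀ x : ZMod 2, x = 0 ∨ x = 1 := by decide
  have hT' : ModularGroup.T ∈ Gamma0 L' := T_mem_Gamma0 L'
  have hT : ModularGroup.T ∈ Gamma0 (L' * 2) := T_mem_Gamma0 (L' * 2)
  obtain ⟨eT1, eT2, eT3, eT4, eT5⟩ := mul_T_apply g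
  rcases two ((g 1 0 : ℤ) : ZMod 2) with hr | hr
  · -- `g ∈ Γ₀(2L′)`
    have hgB : g ∈ Gamma0 (L' * 2) := (mem_Gamma0_mul_two_iff hL' hg).mpr hr
    have e : (⟨g⁻¹ * h * g, hk⟩ : Gamma0 (L' * 2)) = ⟨g, hgB⟩⁻¹ * h * ⟨g, hgB⟩ := rfl
    rw [e, cocycle_zero_inv_conj hu]
  rcases two ((g 0 1 : ℤ) : ZMod 2) with hq | hq
  · -- `2 ∣ g₀₁`
    exact apply_inv_conj_eq_of_even hu hshift hg ((two_dvd_iff_cast_zmod_two_eq_zero _).mpr hq) h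
      (even_of_inv_conj_mem hr h hk) hk
  rcases two ((g 0 0 : ℤ) : ZMod 2) with hp | hp
  · rcases two ((g 1 1 : ℤ) : ZMod 2) with hs | hs
    · -- `p, s` even: use `g₁ = τ g τ`, `h₁ = τ h τ⁻¹`
      obtain ⟨fT1, fT2, fT3, fT4, fT5⟩ := mul_T_apply (ModularGroup.T * g)
      have hg₁ : ModularGroup.T * g * ModularGroup.T ∈ Gamma0 L' :=
        Subgroup.mul_mem _ (Subgroup.mul_mem _ hT' hg) hT'
      have hg₁01 : (2 : ℤ) ∣ (ModularGroup.T * g * ModularGroup.T) 0 1 := by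
        rw [two_dvd_iff_cast_zmod_two_eq_zero, fT1, eT3, eT4]
        push_cast
        rw [hp, hr, hq, hs]; decide
      have hg₁10 : (((ModularGroup.T * g * ModularGroup.T) 1 0 : ℤ) : ZMod 2) = 1 := by rw [fT2, eT5, hr]
      let h₁ : Gamma0 (L' * 2) := ⟨ModularGroup.T, hT⟩ * h * ⟨ModularGroup.T, hT⟩⁻¹
      have hk₁ : (ModularGroup.T * g * ModularGroup.T)⁻¹ * (h₁ : SL(2, ℤ)) * (ModularGroup.T * g * ModularGroup.T) ∈
          Gamma0 (L' * 2) := by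
        have e : (ModularGroup.T * g * ModularGroup.T)⁻¹ * (h₁ : SL(2, ℤ)) * (ModularGroup.T * g * ModularGroup.T) =
            ModularGroup.T⁻¹ * (g⁻¹ * h * g) * ModularGroup.T := by
          simp only [h₁, Subgroup.coe_mul, Subgroup.coe_inv]; group
        rw [e]
        exact Subgroup.mul_mem _ (Subgroup.mul_mem _ (Subgroup.inv_mem _ hT) hk) hT
      have key := apply_inv_conj_eq_of_even hu hshift hg₁ hg₁01 h₁ (even_of_inv_conj_mem hg₁10 h₁ hk₁) hk₁
      have e1 : (⟨(ModularGroup.T * g * ModularGroup.T)⁻¹ * (h₁ : SL(2, ℤ)) * (ModularGroup.T * g * ModularGroup.T), hk₁⟩ :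
          Gamma0 (L' * 2)) = ⟨ModularGroup.T, hT⟩⁻¹ * ⟨g⁻¹ * h * g, hk⟩ * ⟨ModularGroup.T, hT⟩ := by
        apply Subtype.ext
        simp only [h₁, Subgroup.coe_mul, Subgroup.coe_inv]
        group
      rw [e1, cocycle_zero_inv_conj hu] at key
      rw [key]
      exact cocycle_zero_conj hu _ _
    · -- `p` even, `s` odd: use `g₁ = τ g`, `h₁ = τ h τ⁻¹`
      have hg₁ : ModularGroup.T * g ∈ Gamma0 L' := Subgroup.mul_mem _ hT' hg
      have hg₁01 : (2 : ℤ) ∣ (ModularGroup.T * g) 0 1 := by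
        rw [two_dvd_iff_cast_zmod_two_eq_zero, eT4]
        push_cast
        rw [hq, hs]; decide
      have hg₁10 : (((ModularGroup.T * g) 1 0 : ℤ) : ZMod 2) = 1 := by rw [eT5, hr]
      let h₁ : Gamma0 (L' * 2) := ⟨ModularGroup.T, hT⟩ * h * ⟨ModularGroup.T, hT⟩⁻¹
      have hk₁ : (ModularGroup.T * g)⁻¹ * (h₁ : SL(2, ℤ)) * (ModularGroup.T * g) ∈ Gamma0 (L' * 2) := by
        have e : (ModularGroup.T * g)⁻¹ * (h₁ : SL(2, ℤ)) * (ModularGroup.T * g) = g⁻¹ * h * g := by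
          simp only [h₁, Subgroup.coe_mul, Subgroup.coe_inv]; group
        rw [e]; exact hk
      have key := apply_inv_conj_eq_of_even hu hshift hg₁ hg₁01 h₁ (even_of_inv_conj_mem hg₁10 h₁ hk₁) hk₁
      have e1 : (⟨(ModularGroup.T * g)⁻¹ * (h₁ : SL(2, ℤ)) * (ModularGroup.T * g), hk₁⟩ : Gamma0 (L' * 2)) =
          ⟨g⁻¹ * h * g, hk⟩ := by
        apply Subtype.ext
        simp only [h₁, Subgroup.coe_mul, Subgroup.coe_inv]
        group
      rw [e1] at key
      rw [key]
      exact cocycle_zero_conj hu _ _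
  · -- `p` odd: use `g₁ = g τ`
    have hg₁ : g * ModularGroup.T ∈ Gamma0 L' := Subgroup.mul_mem _ hg hT'
    have hg₁01 : (2 : ℤ) ∣ (g * ModularGroup.T) 0 1 := by
      rw [two_dvd_iff_cast_zmod_two_eq_zero, eT1]
      push_cast
      rw [hp, hq]; decide
    have hg₁10 : (((g * ModularGroup.T) 1 0 : ℤ) : ZMod 2) = 1 := by rw [eT2, hr]
    have hk₁ : (g * ModularGroup.T)⁻¹ * (h : SL(2, ℤ)) * (g * ModularGroup.T) ∈ Gamma0 (L' * 2) := by
      have e : (g * ModularGroup.T)⁻¹ * (h : SL(2, ℤ)) * (g * ModularGroup.T) =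
          ModularGroup.T⁻¹ * (g⁻¹ * h * g) * ModularGroup.T := by group
      rw [e]
      exact Subgroup.mul_mem _ (Subgroup.mul_mem _ (Subgroup.inv_mem _ hT) hk) hT
    have key := apply_inv_conj_eq_of_even hu hshift hg₁ hg₁01 h (even_of_inv_conj_mem hg₁10 h hk₁) hk₁
    have e1 : (⟨(g * ModularGroup.T)⁻¹ * (h : SL(2, ℤ)) * (g * ModularGroup.T), hk₁⟩ : Gamma0 (L' * 2)) =
        ⟨ModularGroup.T, hT⟩⁻¹ * ⟨g⁻¹ * h * g, hk⟩ * ⟨ModularGroup.T, hT⟩ := by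
      apply Subtype.ext
      simp only [Subgroup.coe_mul, Subgroup.coe_inv]
      group
    rw [e1, cocycle_zero_inv_conj hu] at key
    exact key

end Stability

end Summit.BirchSwinnertonDyer.BirchSwinnertonDyer.Theorems.ManinLocalTwoThree
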